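import Summits.QuantumFields.YangMills.Theorems.UnitScaleTiltProp7SectET3N06LeavesRecordNormH1
import Summits.QuantumFields.YangMills.Theorems.UnitScaleTiltProp7SectET3KernelFamilyCanonical
import Summits.QuantumFields.YangMills.Theorems.UnitScaleTiltProp7SectET3OpsSymmetry
import HarnessLib

/-!
# Route `UnitScaleTilt` (α), node N06(d = 3), THEOREM 3.12 SIDE — **THE `norm_H₁` ∕ `norm_H` ROWS OF C-min FROM THE RECORD-SPECIES OBLIGATIONS WITH THE TWO KERNEL FAMILIES
# `GD`, `G₁`, THEIR SIX CO-READING ROWS AND THE SYMMETRY ROW DISCHARGED**: ✓ `Prop7SectET3N06LeavesRecordNormH1.normH₁_row_of_recordObligations` (p607026∕p613281, the H-side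
# text of record of INPUT-LIST I-06) re-issued WITHOUT the binders `GD G₁` (the kernel families of G, G₁), `hcoR hco1R hcoG hl2N hH1N hIF` (their co-reading rows) and `hsym`
# (symmetry of G, G₁) — replaced by TEN K-free EVALUATION ROWS and ONE four-conjunct LETTER-SYMMETRY ROW; the H-kernel interface (`Hk H₁k hcoHR hHCN Hsel hmem hpin`, ★w1-20520's
# (U)∕(Σ) pin) and every other binder VERBATIM (the twin of ✓ `Prop7SectET3N06LeavesRecordNormGReduced` for the 𝔊-side)

Cell `ym-inputs` (D-0154 (2); desk `ym-inputs-plan-1` INPUT-LIST v5 §4 row p05 = I-06 (d) «the structural rows … for a concrete `𝔬_T3`»; the H₁ face of block I-06: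
`t312_of_pins_T3_completePairMBZ` → `normH_of_thm312Printed`), seat ym-inputs-p05.  Count-neutral helper (`--supports stmt-QuantumFields-20520 --as helper`; RULING g26-№2 «B0 needs
N06(d = 3)»); registry untouched; THEOREMS ONLY (0 `def`, 0 `sorry`); NOTHING of [Balaban1985BackgroundPropagators] is asserted.

THE COMPOSITION.  ✓ `Prop7SectET3KernelFamilyCanonical.exists_kernelFamily_structural` applied TWICE per member (`G := (𝔬 i).G` and `G := (𝔬 i).G1`, at `Rel := RelB i`, `R := 1`,
`H := H₀ i`; sign facts ✓ `modelSignsOn_geo9K`, ✓ `geoOK_geo9K`) gives `GD i`, `G₁ i` inhabiting the twelve co-reading conjuncts from the evaluation rows `hoff … hlocle`;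
✓ `Prop7SectET3OpsSymmetry.hsym_row_of_letterSymm` gives `hsym` from the `Identities` conjunct of `hmodel` and the letter-symmetry row `hlsym`; then the record theorem BY NAME.
WHAT STAYS DISPLAYED: the H-kernels `Hk`, `H₁k` with their co-readings `hcoHR` (`CoRealizesHRel`, (3.133) sup entries) and `hHCN` (`CoReadsHHolderNbr`, (3.133) Hölder entry), the
selector `Hsel ∈ {Hk, H₁k}` and the (U)∕(Σ) pin `hpin` reading `Hsel`'s entries — their joint consistency for ONE kernel is ✓ `Prop7SectET3NormH1Canonical.exists_hKernel_canonical`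
(★w1-20520 g4); they are the lane holder's interface and are not re-cut here.  §2 `normH_row_of_evaluationRows_H` = the same at `Hsel := Hk` (print's first H-kernel `H =
GQ*(QGQ*)⁻¹`, [Balaban1985Variational] (45)–(46); OWNER RULING g26-№10∕№12: the EX (46)-twˢ size row is this storey BY ANALOGY for `Q := Tube^{sym}_cov`).
NET FOR SUB-ROW (d) OF I-06 (H-side): the concrete T³ instance owes NO kernel family `GD`∕`G₁`, NONE of their co-reading rows and NO symmetry row — it owes the ten evaluation facts,
four letter symmetries, and the H-kernel interface above; the ANALYTIC rows and `ClassTransferT3` are untouched.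
HONEST SCOPE: bookkeeping; N06(d = 3) NOT discharged; the route's curved letters `H₁f`∕`H` (layer 0, `Q := Tube^{sym}_cov`) are NOT defined here; nothing here claims EX, the
crux, V3∕R3, d = 4 or the mass gap; YM₃ on T³ is ladder rung R3, not the Clay problem.

References: T. Bałaban, CMP **99** (1985) 389–434 [Balaban1985BackgroundPropagators] ((3.39)–(3.47) pp.397–398, (3.126) p.420, (3.133) p.422, Thm 3.12 p.423); CMP **102**
(1985) 277–309 [Balaban1985Variational] ((45)–(46) p.285, (103) p.293, (115) p.294); CMP **96** (1984) 223–250 [Balaban1984PropagatorsII] ((2.61) p.234); CMP **99** (1985)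
75–102 [Balaban1985RegularSpaces] ((1.33) p.82).
-/

set_option autoImplicit false

noncomputable section

open scoped Matrix.Norms.L2Operator

namespace Summit.QuantumFields.YangMills.Theorems.Prop7SectET3N06LeavesRecordNormH1Reduced

open Literature.MathematicalPhysics.QuantumFieldTheory.Balaban1983to89
open Finset B6RandomWalk B6RandomWalkHom B9Thm34Ext B9Thm37Glue B9Thm37GlueCor36 B11SectG B9SectDSup B9SectDL2Decay
open B9Thm37AllNorms B9Thm37AllNormsInstances B9FromB6 B9FromB6ModelSignsOn B9SectBStepWhole B9Thm312Whole B9Thm312WholeLeaf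
open B9Thm312WholeLeft B9Thm312WholeH B9Thm312WholeLeafLeftGlob B9Ineq347CoReading B9SectCDiffDict B9CoRealizesRel B9CoRealizesHRel
open B9RWSums343Holder B9RWSumsReadsRel B9RWSumsReadsNbr B9Ineq347 B9Thm312WholeClasses B9Thm312WholeHolder B9Thm312WholeL2
open B9Thm312WholeBlocksRel B9Thm312WholeBlocksNbr B9Thm312WholeLeafAll B9Thm312WholeHHolder B9Thm312WholeHHolderNbr B9Thm312WholeLeafRelH
open B9RWSums346SecondDiff B9Thm312WholeLeafCompleteNbr B9Thm312WholeBlocksNbrRec B9RWSums344InputFam B9Thm312WholeDir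
open B9Thm312WholeBlocksPairM B9Thm312WholeLeafCompletePairM B9Thm312WholeDirB B9Thm312WholeBlocksPairMB B9Thm312WholeHZ B9Thm312WholeLeafRelHZ
open B6KLevelCensusIndexV1 (KIdx)
open B9GeoNormsKLevelV1 (geo9K)
open B9CoRealizesRelAtLetters (RelB)
open B9GeoNormsKLevelModelSignsV1 (modelSignsOn_geo9K)
open Summit.QuantumFields.YangMills.Theorems.Prop7SectET3Members (hd3 memberIdx)
open Summit.QuantumFields.YangMills.Theorems.Prop7SectET3Geometry (geoOK_geo9K)
open Summit.QuantumFields.YangMills.Theorems.Prop7SectET3BgClass (bgT3 cfgV1OfT3 ClassTransferT3)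
open Summit.QuantumFields.YangMills.Theorems.Prop7SectET3N06LeavesRecordNormH1 (normH₁_row_of_recordObligations)
open Summit.QuantumFields.YangMills.Theorems.Prop7SectET3KernelFamilyCanonical (exists_kernelFamily_structural)
open Summit.QuantumFields.YangMills.Theorems.Prop7SectET3OpsSymmetry (hsym_row_of_letterSymm)
open T3ContinuumYM3Torus T3PrintedRegularMinimiser B6GlobalChartV1

variable {ℓ : ℕ} {hL : Odd (ℓ + 1) ∧ 1 < ℓ + 1} {c35 : ℝ}

/-! ## §1 The `norm_H₁` row with the kernel families, their co-readings and the symmetry row discharged -/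

/-- ★★★ **THE `norm_H₁` ROW OF C-min FROM THE RECORD-SPECIES N06(d = 3) OBLIGATIONS (THEOREM 3.12 SIDE) — KERNEL FAMILIES `GD`, `G₁`, THEIR CO-READINGS AND THE SYMMETRY ROW
DISCHARGED.**  The binders of ✓ `normH₁_row_of_recordObligations` VERBATIM (letters `𝔬`, probes `𝔭`, input block norms `bHX`, direction letters `Dd Dds`, H-kernels `Hk H₁k` with
`hcoHR`∕`hHCN`, evaluations `ev evY`, numerics, `hmodel` (Thm 3.3 for `G₀` = XL), `hleft`, `bZ`∕`hκZ`, `hlettersH`, `hG0C`, `hstepC`, `hLHH`, `ClassTransferT3 ℓ hL c35`, the selector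
`Hsel ∈ {Hk, H₁k}`, the normed family `Hop` and the (U)∕(Σ) pin `hls`∕`hpin`) EXCEPT: NO kernel families `GD G₁`, NO rows `hcoR hco1R hcoG hl2N hH1N hIF hsym`; INSTEAD the ten
K-free evaluation rows `hoff hoffY hbd hbdY hwb hwbY hl2b hl2bY hloc hlocle` and the letter-symmetry row `hlsym` (Δ_a = `S0`, Δ′_π = `Tpi`, Δ⁽²⁾_π = `T2` symmetric, (∇_U, ∇*_U) =
(`D`, `Dstar`) a transpose pair, under the printed provisos).  Conclusion VERBATIM: `∃ M₄ a₀ B₀′ > 0, ∀ member …, RegPr … e U₀ → e ≤ a₀∕(L·L^{a'}) → ∀ b, ‖Hop (memberIdx …)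
(cfgV1OfT3 U₀) b‖ ≤ B₀′‖b‖` — the text of `SectEDatum.norm_H₁` ∕ (103).  Nothing of print asserted; NOT a discharge of N06(d = 3).
[cite: Balaban1985Variational, (103) p.293, (115) p.294; Balaban1985BackgroundPropagators, Thm 3.12 pp.421-423, (3.133) p.422, (3.39)-(3.47) pp.397-398; Balaban1984PropagatorsII, (2.61) p.234; Balaban1985RegularSpaces, (1.33) p.82] -/
theorem normH₁_row_of_evaluationRows [∀ i : KIdx 2 ℓ hd3 hL 1 1, Fintype (geo9K i).Site] [∀ i : KIdx 2 ℓ hd3 hL 1 1, DecidableEq (geo9K i).Site]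
    {X Y Z W PX PY : KIdx 2 ℓ hd3 hL 1 1 → Type} {P : Type} [∀ i, Fintype (X i)] [∀ i, DecidableEq (X i)] [∀ i, Fintype (Y i)]
    [∀ i, Fintype (Z i)] [∀ i, Fintype (W i)] [∀ i, Fintype (PX i)] [∀ i, Fintype (PY i)] [Fintype P]
    (𝔬 : ∀ i : KIdx 2 ℓ hd3 hL 1 1, Ops (geo9K i) (bgT3 i) (X i) (Y i) (Z i) (W i)) (H₀ : KIdx 2 ℓ hd3 hL 1 1 → Prop)
    (𝔭 : ∀ i : KIdx 2 ℓ hd3 hL 1 1, HolderProbes (geo9K i) (bgT3 i) (X i) (Y i) (PX i) (PY i))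
    (bHX : ∀ i : KIdx 2 ℓ hd3 hL 1 1, ℝ → BlockNorm (toB6 (geo9K i) 1 (H₀ i)) (X i → ℝ))
    (Dd Dds : ∀ i : KIdx 2 ℓ hd3 hL 1 1, (bgT3 i).Cfg → P → Module.End ℝ (X i → ℝ))
    (Hk H₁k : ∀ i : KIdx 2 ℓ hd3 hL 1 1, B9.HKernel (geo9K i) (bgT3 i))
    (ev : ∀ i : KIdx 2 ℓ hd3 hL 1 1, (geo9K i).Loc → X i → ℝ) (evY : ∀ i : KIdx 2 ℓ hd3 hL 1 1, (geo9K i).Loc → Y i → ℝ)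
    (r Cev θ₁ θD θ₂ r₁ B₀ B₂ δ₀ δK σ ρ ρf a₁ M₁ B₃ δ₃ α : ℝ) (Bh Bi Bq θH θI : ℝ → ℝ) (Bi2 : ℝ → ℝ → ℝ)
    (hθ₁ : 0 ≤ θ₁) (hθD : 0 ≤ θD) (hθH : ∀ β, 0 ≤ β → β < 1 → 0 ≤ θH β) (hθI : ∀ ε, 0 < ε → 0 ≤ θI ε) (hθ₂ : 0 ≤ θ₂) (hr₁ : 0 ≤ r₁) (hB₀ : 0 ≤ B₀) (hB₂ : 0 ≤ B₂) (hB₃ : 0 ≤ B₃)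
    (hσ : 0 < σ) (hρ : 0 < ρ) (hρS : ρ ≤ δ₀) (hρδ : ρ + σ ≤ δK) (hρ₃ : ρ + σ ≤ δ₃) (ha₁ : 0 < a₁) (hM₁ : 0 < M₁)
    (hα : α ≤ 1 / 2) (hα0 : 0 < α) (hρf : 0 < ρf) (hρf1 : ρf + σ ≤ (1 - α) * ρ) (hρf2 : ρf + 2 * σ + α * ρ ≤ ρ)
    (hBh : ∀ β, 0 ≤ β → β < 1 → 0 ≤ Bh β) (hBi : ∀ ε, 0 < ε → ε ≤ 1 → 0 ≤ Bi ε)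
    (hBi2 : ∀ ε β, 0 < ε → ε ≤ 1 → 0 ≤ β → β < 1 → 0 ≤ Bi2 ε β) (hBq : ∀ β, 0 ≤ Bq β)
    (hCev : 0 ≤ Cev)
    -- ======== the TEN K-free EVALUATION ROWS (replace the kernel families `GD`, `G₁` and their rows `hcoR hco1R hcoG hl2N hH1N hIF`) ========
    (hoff : ∀ (i : KIdx 2 ℓ hd3 hL 1 1) (lam : (geo9K i).Loc) (y' : (geo9K i).Site), (geo9K i).suppIn lam y' →
      ∀ x : X i, ¬ RelB i ((𝔬 i).blk x) y' → ev i lam x = 0)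
    (hoffY : ∀ (i : KIdx 2 ℓ hd3 hL 1 1) (lam : (geo9K i).Loc) (y' : (geo9K i).Site), (geo9K i).suppIn lam y' →
      ∀ w : Y i, ¬ RelB i ((𝔬 i).blkY w) y' → evY i lam w = 0)
    (hbd : ∀ (i : KIdx 2 ℓ hd3 hL 1 1) (lam : (geo9K i).Loc) (x : X i), |ev i lam x| ≤ (geo9K i).supNorm lam)
    (hbdY : ∀ (i : KIdx 2 ℓ hd3 hL 1 1) (lam : (geo9K i).Loc) (w : Y i), |evY i lam w| ≤ (geo9K i).supNorm lam)
    (hwb : ∀ (i : KIdx 2 ℓ hd3 hL 1 1) (lam : (geo9K i).Loc) (γ : ℝ) (x : X i), |ev i lam x| ≤ (geo9K i).len ((𝔬 i).blk x) ^ γ * (geo9K i).wNorm γ lam)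
    (hwbY : ∀ (i : KIdx 2 ℓ hd3 hL 1 1) (lam : (geo9K i).Loc) (γ : ℝ) (w : Y i), |evY i lam w| ≤ (geo9K i).len ((𝔬 i).blkY w) ^ γ * (geo9K i).wNorm γ lam)
    (hl2b : ∀ (i : KIdx 2 ℓ hd3 hL 1 1) (lam : (geo9K i).Loc) (y' y'' : (geo9K i).Site), (geo9K i).suppIn lam y' → RelB i y'' y' →
      bl2 (g := toB6 (geo9K i) 1 (H₀ i)) (𝔬 i).blk y'' (ev i lam) ≤ Cev * (geo9K i).l2Norm lam)
    (hl2bY : ∀ (i : KIdx 2 ℓ hd3 hL 1 1) (lam : (geo9K i).Loc) (y' y'' : (geo9K i).Site), (geo9K i).suppIn lam y' → RelB i y'' y' →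
      bl2 (g := toB6 (geo9K i) 1 (H₀ i)) (𝔬 i).blkY y'' (evY i lam) ≤ Cev * (geo9K i).l2Norm lam)
    (hloc : ∀ (i : KIdx 2 ℓ hd3 hL 1 1) (ε : ℝ) (lam : (geo9K i).Loc) (y' : (geo9K i).Site), (geo9K i).suppInT lam y' → (bHX i ε).IsLoc y' (ev i lam))
    (hlocle : ∀ (i : KIdx 2 ℓ hd3 hL 1 1) (ε : ℝ) (lam : (geo9K i).Loc) (y' : (geo9K i).Site), (geo9K i).suppInT lam y' →
      (bHX i ε).loc y' (ev i lam) ≤ (geo9K i).holder ε lam + (geo9K i).supNorm lam)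
    -- ======== the H-kernel co-readings, VERBATIM ========
    (hcoHR : ∀ (i : KIdx 2 ℓ hd3 hL 1 1) (U : (bgT3 i).Cfg),
      CoRealizesHRel (Hk i) 0 U (2 + 1) (RelB i) (𝔬 i).blk (𝔬 i).blkZ ((𝔬 i).Hm U) ∧
      CoRealizesHRel (Hk i) 1 U (2 + 1) (RelB i) (𝔬 i).blkY (𝔬 i).blkZ ((𝔬 i).D U ∘ₗ (𝔬 i).Hm U) ∧
      CoRealizesHRel (H₁k i) 0 U (2 + 1) (RelB i) (𝔬 i).blk (𝔬 i).blkZ ((𝔬 i).H1m U) ∧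
      CoRealizesHRel (H₁k i) 1 U (2 + 1) (RelB i) (𝔬 i).blkY (𝔬 i).blkZ ((𝔬 i).D U ∘ₗ (𝔬 i).H1m U))
    (hHCN : ∀ (i : KIdx 2 ℓ hd3 hL 1 1) (U : (bgT3 i).Cfg),
      CoReadsHHolderNbr (Hk i) U (2 + 1) (𝔭 i) r (𝔬 i).blkZ ((𝔬 i).D U ∘ₗ (𝔬 i).Hm U) ∧
      CoReadsHHolderNbr (H₁k i) U (2 + 1) (𝔭 i) r (𝔬 i).blkZ ((𝔬 i).D U ∘ₗ (𝔬 i).H1m U))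
    -- ======== the LETTER-SYMMETRY ROW (replaces `hsym`) ========
    (hlsym : ∀ i : KIdx 2 ℓ hd3 hL 1 1, M₁ ≤ (geo9K i).M → ∀ α₀ : ℝ, 0 < α₀ → (geo9K i).M * α₀ ≤ a₁ →
      ∀ U : (bgT3 i).Cfg, (bgT3 i).Reg335 c35 α₀ U → (bgT3 i).Reg336 c35 α₀ U →
        IsTransposePair ((𝔬 i).S0 U) ((𝔬 i).S0 U) ∧ IsTransposePair ((𝔬 i).Tpi U) ((𝔬 i).Tpi U) ∧
          IsTransposePair ((𝔬 i).T2 U) ((𝔬 i).T2 U) ∧ IsTransposePair ((𝔬 i).D U) ((𝔬 i).Dstar U))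
    -- ======== the analytic rows, the class-transfer row and the (U)∕(Σ) pin, VERBATIM ========
    (hmodel : ∀ i : KIdx 2 ℓ hd3 hL 1 1, M₁ ≤ (geo9K i).M → ∀ α₀ : ℝ, 0 < α₀ → (geo9K i).M * α₀ ≤ a₁ →
      ∀ U : (bgT3 i).Cfg, (bgT3 i).Reg335 c35 α₀ U → (bgT3 i).Reg336 c35 α₀ U →
        Thm33G0 (𝔬 i) 1 (H₀ i) B₀ δ₀ U ∧
        Step (𝔬 i) 1 (H₀ i) (geoOK_geo9K i).lenle 1 (θ₁ * ((geo9K i).M * α₀)) δK U ∧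
        Step (𝔬 i) 1 (H₀ i) (geoOK_geo9K i).lenle 2 (θ₁ * ((geo9K i).M * α₀)) δK U ∧
        FormSmall (𝔬 i) (r₁ * ((geo9K i).M * α₀)) U ∧ Identities (𝔬 i) U)
    (hleft : ∀ i : KIdx 2 ℓ hd3 hL 1 1, M₁ ≤ (geo9K i).M → ∀ α₀ : ℝ, 0 < α₀ → (geo9K i).M * α₀ ≤ a₁ →
      ∀ U : (bgT3 i).Cfg, (bgT3 i).Reg335 c35 α₀ U → (bgT3 i).Reg336 c35 α₀ U →
        LeftStep (𝔬 i) 1 (H₀ i) (geoOK_geo9K i).lenle B₀ δ₀ (θD * ((geo9K i).M * α₀)) δK U)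
    (bZ : ∀ i : KIdx 2 ℓ hd3 hL 1 1, BlockNorm (toB6 (geo9K i) 1 (H₀ i)) (Z i → ℝ)) (hκZ : ∀ i : KIdx 2 ℓ hd3 hL 1 1, (bZ i).κ = 1)
    (hlettersH : ∀ i : KIdx 2 ℓ hd3 hL 1 1, M₁ ≤ (geo9K i).M → ∀ α₀ : ℝ, 0 < α₀ → (geo9K i).M * α₀ ≤ a₁ →
      ∀ U : (bgT3 i).Cfg, (bgT3 i).Reg335 c35 α₀ U → (bgT3 i).Reg336 c35 α₀ U →
        LettersHZ (𝔬 i) 1 (H₀ i) (geoOK_geo9K i) (bZ i) B₃ δ₃ U)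
    (hG0C : ∀ i : KIdx 2 ℓ hd3 hL 1 1, M₁ ≤ (geo9K i).M → ∀ α₀ : ℝ, 0 < α₀ → (geo9K i).M * α₀ ≤ a₁ →
      ∀ U : (bgT3 i).Cfg, (bgT3 i).Reg335 c35 α₀ U → (bgT3 i).Reg336 c35 α₀ U →
        Thm33G0Dir (𝔬 i) (𝔭 i) (Dd i) (Dds i) 1 (H₀ i) (bHX i) B₀ Bh Bi Bi2 δ₀ U ∧
          Thm33G0L2M (𝔬 i) (Dd i) (Dds i) 1 (H₀ i) B₂ δ₀ U)
    (hstepC : ∀ i : KIdx 2 ℓ hd3 hL 1 1, M₁ ≤ (geo9K i).M → ∀ α₀ : ℝ, 0 < α₀ → (geo9K i).M * α₀ ≤ a₁ →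
      ∀ U : (bgT3 i).Cfg, (bgT3 i).Reg335 c35 α₀ U → (bgT3 i).Reg336 c35 α₀ U →
        StepDirB (𝔬 i) (𝔭 i) (Dd i) (Dds i) 1 (H₀ i) (bHX i) (geoOK_geo9K i).lenle (θD * ((geo9K i).M * α₀))
          (fun β => θH β * ((geo9K i).M * α₀)) (fun ε => θI ε * ((geo9K i).M * α₀)) δK U ∧
        StepL2 (𝔬 i) 1 (H₀ i) (θ₂ * ((geo9K i).M * α₀)) δK U)
    (hLHH : ∀ i : KIdx 2 ℓ hd3 hL 1 1, M₁ ≤ (geo9K i).M → ∀ α₀ : ℝ, 0 < α₀ → (geo9K i).M * α₀ ≤ a₁ →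
      ∀ U : (bgT3 i).Cfg, (bgT3 i).Reg335 c35 α₀ U → (bgT3 i).Reg336 c35 α₀ U →
        LettersHHZ (𝔬 i) (𝔭 i) 1 (H₀ i) (geoOK_geo9K i).lenle (bZ i) Bq δ₃ U)
    -- ======== the class-transfer row (BG-336), the selected H-kernel and the operator family read by its (3.133) entries through the (U)∕(Σ) pin ========
    (hCT : ClassTransferT3 ℓ hL c35)
    (Hsel : ∀ i : KIdx 2 ℓ hd3 hL 1 1, B9.HKernel (geo9K i) (bgT3 i)) (hmem : ∀ i, Hsel i = Hk i ∨ Hsel i = H₁k i)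
    {Xo Yo : ∀ i : KIdx 2 ℓ hd3 hL 1 1, (bgT3 i).Cfg → Type} [∀ i U, SeminormedAddCommGroup (Xo i U)] [∀ i U, SeminormedAddCommGroup (Yo i U)]
    (Hop : ∀ (i : KIdx 2 ℓ hd3 hL 1 1) (U : (bgT3 i).Cfg), Xo i U → Yo i U) (s : ℝ)
    (hls : ∀ (i : KIdx 2 ℓ hd3 hL 1 1) (y : (geo9K i).Site), (geo9K i).len y ^ s ≤ 1)
    (hpin : ∀ (i : KIdx 2 ℓ hd3 hL 1 1) (U : (bgT3 i).Cfg) (b : Xo i U) (c : ℝ), 0 ≤ c →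
      (∀ (n : Fin 2) (y : (geo9K i).Site),
          (geo9K i).len y ^ ((n : ℝ) + s) * (∑ y' : (geo9K i).Site, (Hsel i).e n U y y' * (geo9K i).len y' ^ ((2 + 1 : ℕ) : ℝ)) * ‖b‖ ≤ c) →
        ‖Hop i U b‖ ≤ c) :
    ∃ M₄ a₀ B₀' : ℝ, 0 < M₄ ∧ 0 < a₀ ∧ 0 < B₀' ∧
      ∀ (hℓ : 4 ≤ ℓ) (m : ℕ) (hm : 1 ≤ m) (n K a' R : ℕ) (hk1 : 1 ≤ K - n) (hsize : a' + 3 ≤ m + n) (hM8 : 8 ≤ (ℓ + 1) ^ a') (hR2 : 2 * (ℓ + 1) ^ 2 ≤ R),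
        M₄ ≤ ((ℓ + 1 : ℕ) : ℝ) * (((ℓ + 1) ^ a' : ℕ) : ℝ) →
        ∀ (e : ℝ) (U₀ : GaugeField (PV 2 ℓ m K hd3 hL) 0 (Matrix.specialUnitaryGroup (Fin 2) ℂ)),
          RegPr (⟨ℓ + 1, hL, m, hm⟩ : T3Family) n K e U₀ → e ≤ a₀ / (((ℓ + 1 : ℕ) : ℝ) * (((ℓ + 1) ^ a' : ℕ) : ℝ)) →
            ∀ b : Xo (memberIdx ℓ hL hℓ m hm n K a' R hk1 hsize hM8 hR2) (cfgV1OfT3 U₀),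
              ‖Hop (memberIdx ℓ hL hℓ m hm n K a' R hk1 hsize hM8 hR2) (cfgV1OfT3 U₀) b‖ ≤ B₀' * ‖b‖ := by
  -- (1) the canonical kernel families for `G` and `G₁`, member by member (✓ `exists_kernelFamily_structural`)
  have hKG := fun i : KIdx 2 ℓ hd3 hL 1 1 =>
    exists_kernelFamily_structural (R := (1 : ℝ)) (H := H₀ i) (𝔬 i).G (𝔬 i).D (𝔬 i).Dstar (Dd i) (Dds i) (𝔭 i) (bHX i) (𝔬 i).blk (𝔬 i).blkY (ev i) (evY i)
      (RelB i) r Cev (fun _ _ _ => 0) (fun _ _ _ => 0) (hoff i) (hoffY i) (hbd i) (hbdY i) (hwb i) (hwbY i) (hl2b i) (hl2bY i) (hloc i) (hlocle i)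
      (modelSignsOn_geo9K i).supNorm_nonneg (modelSignsOn_geo9K i).l2Norm_nonneg (modelSignsOn_geo9K i).cutSup_nonneg (modelSignsOn_geo9K i).cutH_nonneg
      (modelSignsOn_geo9K i).holder_nonneg (geoOK_geo9K i).lenpos
  have hKG1 := fun i : KIdx 2 ℓ hd3 hL 1 1 =>
    exists_kernelFamily_structural (R := (1 : ℝ)) (H := H₀ i) (𝔬 i).G1 (𝔬 i).D (𝔬 i).Dstar (Dd i) (Dds i) (𝔭 i) (bHX i) (𝔬 i).blk (𝔬 i).blkY (ev i) (evY i)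
      (RelB i) r Cev (fun _ _ _ => 0) (fun _ _ _ => 0) (hoff i) (hoffY i) (hbd i) (hbdY i) (hwb i) (hwbY i) (hl2b i) (hl2bY i) (hloc i) (hlocle i)
      (modelSignsOn_geo9K i).supNorm_nonneg (modelSignsOn_geo9K i).l2Norm_nonneg (modelSignsOn_geo9K i).cutSup_nonneg (modelSignsOn_geo9K i).cutH_nonneg
      (modelSignsOn_geo9K i).holder_nonneg (geoOK_geo9K i).lenpos
  choose GD _a3 _ag3 hcoR hco1R hcoG hl2N hH1N hIF _ad0 _ad1 _ad2 _ad4 _agd0 _agd1 _agd2 _asg using hKG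
  choose G₁ _b3 _bg3 hcoR₁ hco1R₁ hcoG₁ hl2N₁ hH1N₁ hIF₁ _bd0 _bd1 _bd2 _bd4 _bgd0 _bgd1 _bgd2 _bsg using hKG1
  -- (2) the symmetry row (✓ `hsym_row_of_letterSymm`) from the `Identities` conjunct of `hmodel` and the letter symmetries
  have hsym := hsym_row_of_letterSymm 𝔬 c35 a₁ M₁ (fun i hM α₀ hα hMa U h5 h6 => (hmodel i hM α₀ hα hMa U h5 h6).2.2.2.2) hlsym
  -- (3) the record theorem BY NAME
  exact normH₁_row_of_recordObligations 𝔬 H₀ 𝔭 bHX Dd Dds GD G₁ Hk H₁k ev evY r Cev θ₁ θD θ₂ r₁ B₀ B₂ δ₀ δK σ ρ ρf a₁ M₁ B₃ δ₃ α Bh Bi Bq θH θI Bi2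
    hθ₁ hθD hθH hθI hθ₂ hr₁ hB₀ hB₂ hB₃ hσ hρ hρS hρδ hρ₃ ha₁ hM₁ hα hα0 hρf hρf1 hρf2 hBh hBi hBi2 hBq hCev
    (fun i U => ⟨(hcoR i U).1, (hcoR i U).2, (hcoR₁ i U).1, (hcoR₁ i U).2⟩) (fun i U => ⟨hco1R i U, hco1R₁ i U⟩) hcoHR
    (fun i U => ⟨(hcoG i U).1, (hcoG i U).2.1, (hcoG i U).2.2, (hcoG₁ i U).1, (hcoG₁ i U).2.1, (hcoG₁ i U).2.2⟩)
    (fun i U => ⟨hl2N i U, hl2N₁ i U⟩) (fun i U => ⟨hH1N i U, hH1N₁ i U⟩) (fun i U => ⟨hIF i U, hIF₁ i U⟩) hHCN hsym hmodel hleft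
    bZ hκZ hlettersH hG0C hstepC hLHH hCT Hsel hmem Hop s hls hpin

/-! ## §2 The same row for print's first H-kernel `H = GQ*(QGQ*)⁻¹` -/

/-- ★★ **THE `norm_H` ROW (PRINT'S FIRST H-KERNEL `H = GQ*(QGQ*)⁻¹`, [Balaban1985Variational] (45)–(46)) WITH THE KERNEL FAMILIES, THEIR CO-READINGS AND THE SYMMETRY ROW
DISCHARGED** — §1 at `Hsel := Hk`, `hmem := fun _ => Or.inl rfl`; the twin of ✓ `normH_row_of_recordObligations_H` (OWNER RULING g26-№10 ADDENDUM ∕ №12 (3): the EX knit's (46)-twˢ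
size row is this N06 storey, consumed BY ANALOGY for `Q := Tube^{sym}_cov`; the identity row (45) = `H`'s defining property is the algebraic row of the (L4) DEFINITION, NOT an N06
output and NOT proved here).  Binders as in §1 without the selector; the (U)∕(Σ) pin reads `Hk i`'s (3.133) entries.  Nothing of print asserted; NOT a discharge of N06(d = 3).
[cite: Balaban1985Variational, (45)-(46) p.285, (115) p.294; Balaban1985BackgroundPropagators, (3.126) p.420, (3.133) p.422, Thm 3.12 pp.421-423; Balaban1984PropagatorsII, (2.61) p.234; Balaban1985RegularSpaces, (1.33) p.82] -/
theorem normH_row_of_evaluationRows_H [∀ i : KIdx 2 ℓ hd3 hL 1 1, Fintype (geo9K i).Site] [∀ i : KIdx 2 ℓ hd3 hL 1 1, DecidableEq (geo9K i).Site]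
    {X Y Z W PX PY : KIdx 2 ℓ hd3 hL 1 1 → Type} {P : Type} [∀ i, Fintype (X i)] [∀ i, DecidableEq (X i)] [∀ i, Fintype (Y i)]
    [∀ i, Fintype (Z i)] [∀ i, Fintype (W i)] [∀ i, Fintype (PX i)] [∀ i, Fintype (PY i)] [Fintype P]
    (𝔬 : ∀ i : KIdx 2 ℓ hd3 hL 1 1, Ops (geo9K i) (bgT3 i) (X i) (Y i) (Z i) (W i)) (H₀ : KIdx 2 ℓ hd3 hL 1 1 → Prop)
    (𝔭 : ∀ i : KIdx 2 ℓ hd3 hL 1 1, HolderProbes (geo9K i) (bgT3 i) (X i) (Y i) (PX i) (PY i))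
    (bHX : ∀ i : KIdx 2 ℓ hd3 hL 1 1, ℝ → BlockNorm (toB6 (geo9K i) 1 (H₀ i)) (X i → ℝ))
    (Dd Dds : ∀ i : KIdx 2 ℓ hd3 hL 1 1, (bgT3 i).Cfg → P → Module.End ℝ (X i → ℝ))
    (Hk H₁k : ∀ i : KIdx 2 ℓ hd3 hL 1 1, B9.HKernel (geo9K i) (bgT3 i))
    (ev : ∀ i : KIdx 2 ℓ hd3 hL 1 1, (geo9K i).Loc → X i → ℝ) (evY : ∀ i : KIdx 2 ℓ hd3 hL 1 1, (geo9K i).Loc → Y i → ℝ)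
    (r Cev θ₁ θD θ₂ r₁ B₀ B₂ δ₀ δK σ ρ ρf a₁ M₁ B₃ δ₃ α : ℝ) (Bh Bi Bq θH θI : ℝ → ℝ) (Bi2 : ℝ → ℝ → ℝ)
    (hθ₁ : 0 ≤ θ₁) (hθD : 0 ≤ θD) (hθH : ∀ β, 0 ≤ β → β < 1 → 0 ≤ θH β) (hθI : ∀ ε, 0 < ε → 0 ≤ θI ε) (hθ₂ : 0 ≤ θ₂) (hr₁ : 0 ≤ r₁) (hB₀ : 0 ≤ B₀) (hB₂ : 0 ≤ B₂) (hB₃ : 0 ≤ B₃)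
    (hσ : 0 < σ) (hρ : 0 < ρ) (hρS : ρ ≤ δ₀) (hρδ : ρ + σ ≤ δK) (hρ₃ : ρ + σ ≤ δ₃) (ha₁ : 0 < a₁) (hM₁ : 0 < M₁)
    (hα : α ≤ 1 / 2) (hα0 : 0 < α) (hρf : 0 < ρf) (hρf1 : ρf + σ ≤ (1 - α) * ρ) (hρf2 : ρf + 2 * σ + α * ρ ≤ ρ)
    (hBh : ∀ β, 0 ≤ β → β < 1 → 0 ≤ Bh β) (hBi : ∀ ε, 0 < ε → ε ≤ 1 → 0 ≤ Bi ε)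
    (hBi2 : ∀ ε β, 0 < ε → ε ≤ 1 → 0 ≤ β → β < 1 → 0 ≤ Bi2 ε β) (hBq : ∀ β, 0 ≤ Bq β)
    (hCev : 0 ≤ Cev)
    -- ======== the TEN K-free EVALUATION ROWS (replace the kernel families `GD`, `G₁` and their rows `hcoR hco1R hcoG hl2N hH1N hIF`) ========
    (hoff : ∀ (i : KIdx 2 ℓ hd3 hL 1 1) (lam : (geo9K i).Loc) (y' : (geo9K i).Site), (geo9K i).suppIn lam y' →
      ∀ x : X i, ¬ RelB i ((𝔬 i).blk x) y' → ev i lam x = 0)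
    (hoffY : ∀ (i : KIdx 2 ℓ hd3 hL 1 1) (lam : (geo9K i).Loc) (y' : (geo9K i).Site), (geo9K i).suppIn lam y' →
      ∀ w : Y i, ¬ RelB i ((𝔬 i).blkY w) y' → evY i lam w = 0)
    (hbd : ∀ (i : KIdx 2 ℓ hd3 hL 1 1) (lam : (geo9K i).Loc) (x : X i), |ev i lam x| ≤ (geo9K i).supNorm lam)
    (hbdY : ∀ (i : KIdx 2 ℓ hd3 hL 1 1) (lam : (geo9K i).Loc) (w : Y i), |evY i lam w| ≤ (geo9K i).supNorm lam)
    (hwb : ∀ (i : KIdx 2 ℓ hd3 hL 1 1) (lam : (geo9K i).Loc) (γ : ℝ) (x : X i), |ev i lam x| ≤ (geo9K i).len ((𝔬 i).blk x) ^ γ * (geo9K i).wNorm γ lam)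
    (hwbY : ∀ (i : KIdx 2 ℓ hd3 hL 1 1) (lam : (geo9K i).Loc) (γ : ℝ) (w : Y i), |evY i lam w| ≤ (geo9K i).len ((𝔬 i).blkY w) ^ γ * (geo9K i).wNorm γ lam)
    (hl2b : ∀ (i : KIdx 2 ℓ hd3 hL 1 1) (lam : (geo9K i).Loc) (y' y'' : (geo9K i).Site), (geo9K i).suppIn lam y' → RelB i y'' y' →
      bl2 (g := toB6 (geo9K i) 1 (H₀ i)) (𝔬 i).blk y'' (ev i lam) ≤ Cev * (geo9K i).l2Norm lam)
    (hl2bY : ∀ (i : KIdx 2 ℓ hd3 hL 1 1) (lam : (geo9K i).Loc) (y' y'' : (geo9K i).Site), (geo9K i).suppIn lam y' → RelB i y'' y' →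
      bl2 (g := toB6 (geo9K i) 1 (H₀ i)) (𝔬 i).blkY y'' (evY i lam) ≤ Cev * (geo9K i).l2Norm lam)
    (hloc : ∀ (i : KIdx 2 ℓ hd3 hL 1 1) (ε : ℝ) (lam : (geo9K i).Loc) (y' : (geo9K i).Site), (geo9K i).suppInT lam y' → (bHX i ε).IsLoc y' (ev i lam))
    (hlocle : ∀ (i : KIdx 2 ℓ hd3 hL 1 1) (ε : ℝ) (lam : (geo9K i).Loc) (y' : (geo9K i).Site), (geo9K i).suppInT lam y' →
      (bHX i ε).loc y' (ev i lam) ≤ (geo9K i).holder ε lam + (geo9K i).supNorm lam)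
    -- ======== the H-kernel co-readings, VERBATIM ========
    (hcoHR : ∀ (i : KIdx 2 ℓ hd3 hL 1 1) (U : (bgT3 i).Cfg),
      CoRealizesHRel (Hk i) 0 U (2 + 1) (RelB i) (𝔬 i).blk (𝔬 i).blkZ ((𝔬 i).Hm U) ∧
      CoRealizesHRel (Hk i) 1 U (2 + 1) (RelB i) (𝔬 i).blkY (𝔬 i).blkZ ((𝔬 i).D U ∘ₗ (𝔬 i).Hm U) ∧
      CoRealizesHRel (H₁k i) 0 U (2 + 1) (RelB i) (𝔬 i).blk (𝔬 i).blkZ ((𝔬 i).H1m U) ∧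
      CoRealizesHRel (H₁k i) 1 U (2 + 1) (RelB i) (𝔬 i).blkY (𝔬 i).blkZ ((𝔬 i).D U ∘ₗ (𝔬 i).H1m U))
    (hHCN : ∀ (i : KIdx 2 ℓ hd3 hL 1 1) (U : (bgT3 i).Cfg),
      CoReadsHHolderNbr (Hk i) U (2 + 1) (𝔭 i) r (𝔬 i).blkZ ((𝔬 i).D U ∘ₗ (𝔬 i).Hm U) ∧
      CoReadsHHolderNbr (H₁k i) U (2 + 1) (𝔭 i) r (𝔬 i).blkZ ((𝔬 i).D U ∘ₗ (𝔬 i).H1m U))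
    -- ======== the LETTER-SYMMETRY ROW (replaces `hsym`) ========
    (hlsym : ∀ i : KIdx 2 ℓ hd3 hL 1 1, M₁ ≤ (geo9K i).M → ∀ α₀ : ℝ, 0 < α₀ → (geo9K i).M * α₀ ≤ a₁ →
      ∀ U : (bgT3 i).Cfg, (bgT3 i).Reg335 c35 α₀ U → (bgT3 i).Reg336 c35 α₀ U →
        IsTransposePair ((𝔬 i).S0 U) ((𝔬 i).S0 U) ∧ IsTransposePair ((𝔬 i).Tpi U) ((𝔬 i).Tpi U) ∧
          IsTransposePair ((𝔬 i).T2 U) ((𝔬 i).T2 U) ∧ IsTransposePair ((𝔬 i).D U) ((𝔬 i).Dstar U))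
    -- ======== the analytic rows, the class-transfer row and the (U)∕(Σ) pin on `Hk`, VERBATIM ========
    (hmodel : ∀ i : KIdx 2 ℓ hd3 hL 1 1, M₁ ≤ (geo9K i).M → ∀ α₀ : ℝ, 0 < α₀ → (geo9K i).M * α₀ ≤ a₁ →
      ∀ U : (bgT3 i).Cfg, (bgT3 i).Reg335 c35 α₀ U → (bgT3 i).Reg336 c35 α₀ U →
        Thm33G0 (𝔬 i) 1 (H₀ i) B₀ δ₀ U ∧
        Step (𝔬 i) 1 (H₀ i) (geoOK_geo9K i).lenle 1 (θ₁ * ((geo9K i).M * α₀)) δK U ∧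
        Step (𝔬 i) 1 (H₀ i) (geoOK_geo9K i).lenle 2 (θ₁ * ((geo9K i).M * α₀)) δK U ∧
        FormSmall (𝔬 i) (r₁ * ((geo9K i).M * α₀)) U ∧ Identities (𝔬 i) U)
    (hleft : ∀ i : KIdx 2 ℓ hd3 hL 1 1, M₁ ≤ (geo9K i).M → ∀ α₀ : ℝ, 0 < α₀ → (geo9K i).M * α₀ ≤ a₁ →
      ∀ U : (bgT3 i).Cfg, (bgT3 i).Reg335 c35 α₀ U → (bgT3 i).Reg336 c35 α₀ U →
        LeftStep (𝔬 i) 1 (H₀ i) (geoOK_geo9K i).lenle B₀ δ₀ (θD * ((geo9K i).M * α₀)) δK U)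
    (bZ : ∀ i : KIdx 2 ℓ hd3 hL 1 1, BlockNorm (toB6 (geo9K i) 1 (H₀ i)) (Z i → ℝ)) (hκZ : ∀ i : KIdx 2 ℓ hd3 hL 1 1, (bZ i).κ = 1)
    (hlettersH : ∀ i : KIdx 2 ℓ hd3 hL 1 1, M₁ ≤ (geo9K i).M → ∀ α₀ : ℝ, 0 < α₀ → (geo9K i).M * α₀ ≤ a₁ →
      ∀ U : (bgT3 i).Cfg, (bgT3 i).Reg335 c35 α₀ U → (bgT3 i).Reg336 c35 α₀ U →
        LettersHZ (𝔬 i) 1 (H₀ i) (geoOK_geo9K i) (bZ i) B₃ δ₃ U)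
    (hG0C : ∀ i : KIdx 2 ℓ hd3 hL 1 1, M₁ ≤ (geo9K i).M → ∀ α₀ : ℝ, 0 < α₀ → (geo9K i).M * α₀ ≤ a₁ →
      ∀ U : (bgT3 i).Cfg, (bgT3 i).Reg335 c35 α₀ U → (bgT3 i).Reg336 c35 α₀ U →
        Thm33G0Dir (𝔬 i) (𝔭 i) (Dd i) (Dds i) 1 (H₀ i) (bHX i) B₀ Bh Bi Bi2 δ₀ U ∧
          Thm33G0L2M (𝔬 i) (Dd i) (Dds i) 1 (H₀ i) B₂ δ₀ U)
    (hstepC : ∀ i : KIdx 2 ℓ hd3 hL 1 1, M₁ ≤ (geo9K i).M → ∀ α₀ : ℝ, 0 < α₀ → (geo9K i).M * α₀ ≤ a₁ →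
      ∀ U : (bgT3 i).Cfg, (bgT3 i).Reg335 c35 α₀ U → (bgT3 i).Reg336 c35 α₀ U →
        StepDirB (𝔬 i) (𝔭 i) (Dd i) (Dds i) 1 (H₀ i) (bHX i) (geoOK_geo9K i).lenle (θD * ((geo9K i).M * α₀))
          (fun β => θH β * ((geo9K i).M * α₀)) (fun ε => θI ε * ((geo9K i).M * α₀)) δK U ∧
        StepL2 (𝔬 i) 1 (H₀ i) (θ₂ * ((geo9K i).M * α₀)) δK U)
    (hLHH : ∀ i : KIdx 2 ℓ hd3 hL 1 1, M₁ ≤ (geo9K i).M → ∀ α₀ : ℝ, 0 < α₀ → (geo9K i).M * α₀ ≤ a₁ →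
      ∀ U : (bgT3 i).Cfg, (bgT3 i).Reg335 c35 α₀ U → (bgT3 i).Reg336 c35 α₀ U →
        LettersHHZ (𝔬 i) (𝔭 i) 1 (H₀ i) (geoOK_geo9K i).lenle (bZ i) Bq δ₃ U)
    -- ======== the class-transfer row (BG-336), the selected H-kernel and the operator family read by its (3.133) entries through the (U)∕(Σ) pin ========
    (hCT : ClassTransferT3 ℓ hL c35)
    {Xo Yo : ∀ i : KIdx 2 ℓ hd3 hL 1 1, (bgT3 i).Cfg → Type} [∀ i U, SeminormedAddCommGroup (Xo i U)] [∀ i U, SeminormedAddCommGroup (Yo i U)]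
    (Hop : ∀ (i : KIdx 2 ℓ hd3 hL 1 1) (U : (bgT3 i).Cfg), Xo i U → Yo i U) (s : ℝ)
    (hls : ∀ (i : KIdx 2 ℓ hd3 hL 1 1) (y : (geo9K i).Site), (geo9K i).len y ^ s ≤ 1)
    (hpin : ∀ (i : KIdx 2 ℓ hd3 hL 1 1) (U : (bgT3 i).Cfg) (b : Xo i U) (c : ℝ), 0 ≤ c →
      (∀ (n : Fin 2) (y : (geo9K i).Site),
          (geo9K i).len y ^ ((n : ℝ) + s) * (∑ y' : (geo9K i).Site, (Hk i).e n U y y' * (geo9K i).len y' ^ ((2 + 1 : ℕ) : ℝ)) * ‖b‖ ≤ c) →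
        ‖Hop i U b‖ ≤ c) :
    ∃ M₄ a₀ B₀' : ℝ, 0 < M₄ ∧ 0 < a₀ ∧ 0 < B₀' ∧
      ∀ (hℓ : 4 ≤ ℓ) (m : ℕ) (hm : 1 ≤ m) (n K a' R : ℕ) (hk1 : 1 ≤ K - n) (hsize : a' + 3 ≤ m + n) (hM8 : 8 ≤ (ℓ + 1) ^ a') (hR2 : 2 * (ℓ + 1) ^ 2 ≤ R),
        M₄ ≤ ((ℓ + 1 : ℕ) : ℝ) * (((ℓ + 1) ^ a' : ℕ) : ℝ) →
        ∀ (e : ℝ) (U₀ : GaugeField (PV 2 ℓ m K hd3 hL) 0 (Matrix.specialUnitaryGroup (Fin 2) ℂ)),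
          RegPr (⟨ℓ + 1, hL, m, hm⟩ : T3Family) n K e U₀ → e ≤ a₀ / (((ℓ + 1 : ℕ) : ℝ) * (((ℓ + 1) ^ a' : ℕ) : ℝ)) →
            ∀ b : Xo (memberIdx ℓ hL hℓ m hm n K a' R hk1 hsize hM8 hR2) (cfgV1OfT3 U₀),
              ‖Hop (memberIdx ℓ hL hℓ m hm n K a' R hk1 hsize hM8 hR2) (cfgV1OfT3 U₀) b‖ ≤ B₀' * ‖b‖ :=
  normH₁_row_of_evaluationRows 𝔬 H₀ 𝔭 bHX Dd Dds Hk H₁k ev evY r Cev θ₁ θD θ₂ r₁ B₀ B₂ δ₀ δK σ ρ ρf a₁ M₁ B₃ δ₃ α Bh Bi Bq θH θI Bi2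
    hθ₁ hθD hθH hθI hθ₂ hr₁ hB₀ hB₂ hB₃ hσ hρ hρS hρδ hρ₃ ha₁ hM₁ hα hα0 hρf hρf1 hρf2 hBh hBi hBi2 hBq hCev
    hoff hoffY hbd hbdY hwb hwbY hl2b hl2bY hloc hlocle hcoHR hHCN hlsym hmodel hleft bZ hκZ hlettersH hG0C hstepC hLHH hCT Hk (fun _ => Or.inl rfl) Hop s hls hpin

end Summit.QuantumFields.YangMills.Theorems.Prop7SectET3N06LeavesRecordNormH1Reduced

end
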